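import Mathlib
import Summits.Ventures.PercRepro.TriangleCapCapTGenMain

/-!
# PercRepro — THE CAP AT THE CORNER `k = 3a − 1` OF THE CELL `(k, a, a − 1)`, EVERY `a ≥ 5`: a `K₄⁻`-free graph with
`a (2a − 1) − (a − 1)` edges on `3a − 1` vertices and a vertex of degree `2a − 1` is `a`-bipartite or at least
`2 (k − 2a − 1) = 2 (a − 2)` below the closed form (p3, gen 47; part 200k)

Part 200g needs `K ≥ 2r + 2` to kill an edge inside the `a − 1` non-neighbours by the count alone; at the corner
`K = 2r + 1 = 2a − 1` the count leaves `M = 0` (for `a ≥ 6`) with EVERY inequality tight — in particular every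
vertex of `R` at degree exactly `K`, so the two ends `u, v` of the edge have `P_u + P_v = 2K − d_R(u) − d_R(v)
≥ 2K − 2 (a − 2) = 2a + 2`, against `P_u + P_v ≤ K + 1 = 2a` (their common neighbours in `N` are at most one):
`rowB_corner_noedge` is this arithmetic, with the per-vertex degree cap `P_u + d_R(u) ≤ K` of the ends and
`d_R(u) ≤ |R| − 1` (`degIn_le_card_erase`). The rest is part 200g at `K = 2r + 1` (`capT_sq_arith_corner`, slack
`a − 4`). Axioms: standard.
-/

namespace PercRepro

namespace TriangleCap

namespace C047

open Finset

variable {V : Type*} [Fintype V] [DecidableEq V]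

omit [Fintype V] in
/-- `degIn D R u ≤ |R.erase u|`: a vertex is not its own neighbour. -/
theorem degIn_le_card_erase (D : SimpleGraph V) [DecidableRel D.Adj] (R : Finset V) (u : V) :
    degIn D R u ≤ (R.erase u).card := by
  unfold degIn
  apply card_le_card
  intro w hw
  rw [mem_filter] at hw
  exact mem_erase.mpr ⟨(D.ne_of_adj hw.2).symm, hw.1⟩

/-- **THE CORNER COUNT:** `K = 2a − 1`, `r = a − 1`, `a = a' + 5`: an edge `u v` inside `R` is impossible. -/
theorem rowB_corner_noedge (a' K M P E m Pu Pv Pr du dv dr : ℕ) (hK : K = 2 * (a' + 5) - 1)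
    (hdeg : K + (K + 2 * M + P) + (P + E) = 2 * m) (hm : m + (a' + 4) = (a' + 5) * K)
    (h1 : P + E ≤ (a' + 4) * K) (hPuv : Pu + Pv ≤ K + 1) (hrest : Pr + (a' + 2) * M ≤ (a' + 2) * K)
    (hP : P = Pu + Pv + Pr) (hE : E = du + dv + dr) (hu : Pu + du ≤ K) (hv : Pv + dv ≤ K)
    (hr : Pr + dr ≤ (a' + 2) * K) (hdu : du ≤ a' + 3) (hdv : dv ≤ a' + 3) : False := by
  subst hK hP hE
  have e : 2 * (a' + 5) - 1 = 2 * a' + 9 := by omega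
  rw [e] at hdeg hm h1 hPuv hrest hu hv hr
  nlinarith [hdeg, hm, h1, hPuv, hrest, hu, hv, hr, hdu, hdv, Nat.zero_le (a' * M)]

/-- **THE ARITHMETIC OF `M = 1` AT THE CORNER `K = 2a − 1`, `r = a − 1`:** as `capT_sq_arith` with `δ = 1`,
`K = 2r + 1`, slack `a − 4`. -/
theorem capT_sq_arith_corner (a K P SN SR m r : ℕ) (ha : 5 ≤ a) (hra : r + 1 = a) (hK : K = 2 * a - 1)
    (hm : m + r = a * K) (hP : P + r + 1 + K = a * K)
    (hSN : SN ≤ K + 6 + (a + 1) * P + 2 * (a - 1)) (hSR : SR + (2 * K - 3) * 1 ≤ (a - 1) * ((K - 1) * (K - 1))) :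
    K * K + SN + SR + r * (K + a - 1 - r) + 2 * (K + a - 2 * a - 1) ≤ m * (K + a) := by
  obtain ⟨q, rfl⟩ : ∃ q, a = q + 5 := ⟨a - 5, by omega⟩
  obtain rfl : r = q + 4 := by omega
  obtain rfl : K = 2 * q + 9 := by omega
  have e1 : 2 * q + 9 + (q + 5) - 1 - (q + 4) = 2 * q + 9 := by omega
  have e2 : 2 * q + 9 + (q + 5) - 2 * (q + 5) - 1 = q + 3 := by omega
  have e3 : q + 5 - 1 = q + 4 := by omega
  have e4 : 2 * q + 9 - 1 = 2 * q + 8 := by omega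
  have e5 : 2 * (2 * q + 9) - 3 = 4 * q + 15 := by omega
  rw [e1, e2]
  rw [e3, e4, e5] at hSR
  rw [e3] at hSN
  have hm' : m = 2 * q * q + 18 * q + 41 := by ring_nf at hm ⊢; omega
  have hP' : P = 2 * q * q + 16 * q + 31 := by ring_nf at hP ⊢; omega
  subst hm' hP'
  nlinarith [hSN, hSR]

/-- **THE CAP AT THE CORNER `k = 3a − 1` OF `(k, a, a − 1)`, `a ≥ 5`:** a `K₄⁻`-free graph with `a (k − a) − (a − 1)`
edges on `k = 3a − 1` vertices and a vertex `x` of degree `k − a = 2a − 1` is a spanning subgraph of some `K(A, Aᶜ)`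
with `|A| = a`, or `Σ_v d(v)² + (a − 1)(k − a) + 2 (k − 2a − 1) ≤ m k`. -/
theorem cap_B2_corner (D : SimpleGraph V) [DecidableRel D.Adj] (hK : K4mFree D) (a r : ℕ) (ha5 : 5 ≤ a)
    (hra : r + 1 = a) (hk : Fintype.card V = 2 * a + r)
    (hm : D.edgeFinset.card + r = a * (Fintype.card V - a)) (x : V) (hx : deg D x + a = Fintype.card V) :
    (∃ A : Finset V, A.card = a ∧ BipSub D A) ∨
      ∑ v, deg D v * deg D v + r * (Fintype.card V - 1 - r) + 2 * (Fintype.card V - 2 * a - 1) ≤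
        D.edgeFinset.card * Fintype.card V := by
  obtain ⟨N, hN⟩ : ∃ N : Finset V, N = univ.filter (fun w => D.Adj x w) := ⟨_, rfl⟩
  have hmemN : ∀ w, w ∈ N ↔ D.Adj x w := fun w => by rw [hN, mem_filter]; simp only [mem_univ, true_and]
  have hxN : x ∉ N := fun h => D.irrefl ((hmemN x).mp h)
  have hdx : deg D x = N.card := by rw [hN]; rfl
  obtain ⟨K, hKdef⟩ : ∃ K, N.card = K := ⟨_, rfl⟩
  have hcardV : Fintype.card V = K + a := by omega
  have hK2a : K = 2 * a - 1 := by omega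
  obtain ⟨m, hmdef⟩ : ∃ m, D.edgeFinset.card = m := ⟨_, rfl⟩
  have hcap : ∀ v, deg D v + a ≤ Fintype.card V := fun v =>
    deg_add_le_card_of_dense D hK a (by omega) (by omega)
      (cap_arith a (Fintype.card V) D.edgeFinset.card r (by omega) (by omega)
        (below_cap_arith a (Fintype.card V) D.edgeFinset.card r (by omega) hm)) v
  rw [hmdef, hcardV, Nat.add_sub_cancel] at hm
  obtain ⟨R, hR⟩ : ∃ R : Finset V, R = (insert x N)ᶜ := ⟨_, rfl⟩
  have hRcard : R.card + 1 = a := by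
    rw [hR, card_compl, card_insert_of_notMem hxN]
    omega
  have hmemR : ∀ w, w ∈ R ↔ w ≠ x ∧ ¬ D.Adj x w := by
    intro w
    rw [hR, mem_compl, mem_insert, hmemN]
    tauto
  obtain ⟨M, hM⟩ : ∃ M, adjPairs D N = 2 * M := ⟨_, adjPairs_eq_two_mul D N⟩
  have hTf : ∑ y ∈ N, degIn D N y = 2 * M := by rw [← adjPairs_eq_sum_degIn, hM]
  obtain ⟨P, hPdef⟩ : ∃ P, ∑ u ∈ R, degIn D N u = P := ⟨_, rfl⟩
  obtain ⟨E, hEdef⟩ : ∃ E, adjPairs D R = E := ⟨_, rfl⟩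
  have hsplit : ∀ F : V → ℕ, ∑ w, F w = F x + ∑ y ∈ N, F y + ∑ u ∈ R, F u := by
    intro F
    rw [← sum_add_sum_compl (insert x N), sum_insert hxN, ← hR]
  have hdegN : ∀ y ∈ N, deg D y = 1 + degIn D N y + degIn D R y := by
    intro y hy
    have := deg_eq_of_mem_nbhd D x y ((hmemN y).mp hy)
    rw [← hN, ← hR] at this
    exact this
  have hsumN : ∑ y ∈ N, deg D y = K + 2 * M + P := by
    rw [sum_congr rfl hdegN, sum_add_distrib, sum_add_distrib, sum_const, smul_eq_mul, mul_one, hKdef, hTf,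
      sum_degIn_comm D N R, hPdef]
  have hdegR : ∀ u ∈ R, deg D u = degIn D N u + degIn D R u := by
    intro u hu
    have := deg_eq_of_not_mem_nbhd D x u ((hmemR u).mp hu).2
    rw [← hN, ← hR] at this
    exact this
  have hsumR : ∑ u ∈ R, deg D u = P + E := by
    rw [sum_congr rfl hdegR, sum_add_distrib, hPdef, ← adjPairs_eq_sum_degIn, hEdef]
  have hdegsum := sum_deg_eq D
  rw [hsplit, hsumN, hsumR, hdx, hKdef, hmdef] at hdegsum
  have hcapK : ∀ u ∈ R, deg D u ≤ K := fun u _ => by have := hcap u; omega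
  have h1 : P + E ≤ (a - 1) * K := by
    rw [← hsumR]
    calc ∑ u ∈ R, deg D u ≤ ∑ _u ∈ R, K := sum_le_sum (fun u hu => hcapK u hu)
      _ = (a - 1) * K := by rw [sum_const, smul_eq_mul]; congr 1; omega
  have hPle : ∀ u ∈ R, degIn D N u + M ≤ K := by
    intro u hu
    have := two_mul_degIn_add_adjPairs_le D hK (x := x) ((hmemR u).mp hu).1
    rw [← hN, hM, hKdef] at this
    omega
  have h2 : P + (a - 1) * M ≤ (a - 1) * K := by
    have hs : ∑ u ∈ R, (degIn D N u + M) ≤ ∑ _u ∈ R, K := sum_le_sum hPle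
    rw [sum_add_distrib, sum_const, sum_const, smul_eq_mul, smul_eq_mul, hPdef] at hs
    have e : R.card = a - 1 := by omega
    rw [e] at hs
    exact hs
  obtain ⟨a', rfl⟩ : ∃ a', a = a' + 5 := ⟨a - 5, by omega⟩
  have e1 : a' + 5 - 1 = a' + 4 := by omega
  rw [e1] at h1 h2
  -- no edge inside `R`: the corner count
  have hE0 : E = 0 := by
    by_contra hE
    obtain ⟨u, hu, hu1⟩ : ∃ u ∈ R, 1 ≤ degIn D R u := by
      by_contra hcon
      push Not at hcon
      have h0 : ∑ u ∈ R, degIn D R u = 0 := sum_eq_zero (fun u hu => by have := hcon u hu; omega)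
      rw [← adjPairs_eq_sum_degIn, hEdef] at h0
      exact hE h0
    obtain ⟨v, hv, huv⟩ : ∃ v ∈ R, D.Adj u v := by
      unfold degIn at hu1
      obtain ⟨v, hv⟩ := card_pos.mp hu1
      rw [mem_filter] at hv
      exact ⟨v, hv.1, hv.2⟩
    have hne : u ≠ v := D.ne_of_adj huv
    have hPuv : degIn D N u + degIn D N v ≤ K + 1 := by
      have := degIn_add_degIn_le_of_adj_pair D hK N huv
      rw [hKdef] at this
      exact this
    have hvR' : v ∈ R.erase u := mem_erase.mpr ⟨hne.symm, hv⟩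
    have hsum1 := add_sum_erase R (fun w => degIn D N w) hu
    have hsum2 := add_sum_erase (R.erase u) (fun w => degIn D N w) hvR'
    have hsum1' := add_sum_erase R (fun w => degIn D R w) hu
    have hsum2' := add_sum_erase (R.erase u) (fun w => degIn D R w) hvR'
    have hcard2 : ((R.erase u).erase v).card = a' + 2 := by
      rw [card_erase_of_mem hvR', card_erase_of_mem hu]
      omega
    have hrest : ∑ w ∈ (R.erase u).erase v, degIn D N w + (a' + 2) * M ≤ (a' + 2) * K := by
      have hs : ∑ w ∈ (R.erase u).erase v, (degIn D N w + M) ≤ ∑ _w ∈ (R.erase u).erase v, K :=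
        sum_le_sum (fun w hw => hPle w (mem_of_mem_erase (mem_of_mem_erase hw)))
      rw [sum_add_distrib, sum_const, sum_const, smul_eq_mul, smul_eq_mul, hcard2] at hs
      exact hs
    have hr : ∑ w ∈ (R.erase u).erase v, degIn D N w + ∑ w ∈ (R.erase u).erase v, degIn D R w ≤ (a' + 2) * K := by
      rw [← sum_add_distrib]
      calc ∑ w ∈ (R.erase u).erase v, (degIn D N w + degIn D R w)
          = ∑ w ∈ (R.erase u).erase v, deg D w :=
            sum_congr rfl (fun w hw => (hdegR w (mem_of_mem_erase (mem_of_mem_erase hw))).symm)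
        _ ≤ ∑ _w ∈ (R.erase u).erase v, K :=
            sum_le_sum (fun w hw => hcapK w (mem_of_mem_erase (mem_of_mem_erase hw)))
        _ = (a' + 2) * K := by rw [sum_const, smul_eq_mul, hcard2]
    have hu' : degIn D N u + degIn D R u ≤ K := by rw [← hdegR u hu]; exact hcapK u hu
    have hv' : degIn D N v + degIn D R v ≤ K := by rw [← hdegR v hv]; exact hcapK v hv
    have hdu : degIn D R u ≤ a' + 3 := by
      have := degIn_le_card_erase D R u
      rw [card_erase_of_mem hu] at this
      omega
    have hdv : degIn D R v ≤ a' + 3 := by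
      have := degIn_le_card_erase D R v
      rw [card_erase_of_mem hv] at this
      omega
    have hEsum : E = degIn D R u + (degIn D R v + ∑ w ∈ (R.erase u).erase v, degIn D R w) := by
      rw [← hEdef, adjPairs_eq_sum_degIn, ← hsum1', ← hsum2']
    have hPsum : P = degIn D N u + (degIn D N v + ∑ w ∈ (R.erase u).erase v, degIn D N w) := by
      rw [← hPdef, ← hsum1, ← hsum2]
    exact rowB_corner_noedge a' K M P E m _ _ _ _ _ _ hK2a hdegsum
      (by have hr4 : r = a' + 4 := by omega
          rw [hr4] at hm; exact hm) h1 hPuv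
      hrest (by rw [hPsum]; ring) (by rw [hEsum]; ring) hu' hv' hr hdu hdv
  -- `M ≤ 1`
  have hM1' : M ≤ 1 := capT_matching (a' + 5) K M P m r (by omega)
    (by rw [hE0] at hdegsum; exact hdegsum) hm (by rw [e1]; exact h2) (by omega)
  have hnoR : ∀ u ∈ R, degIn D R u = 0 := by
    intro u hu
    have hle : degIn D R u ≤ ∑ z ∈ R, degIn D R z := single_le_sum (fun _ _ => Nat.zero_le _) hu
    rw [← adjPairs_eq_sum_degIn, hEdef, hE0] at hle
    exact Nat.le_zero.mp hle
  rcases Nat.eq_zero_or_pos M with hM0 | hMpos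
  · left
    have hnoN : ∀ y ∈ N, ∀ y', D.Adj y y' → y' ∉ N := by
      intro y hy y' hyy' hy'
      have h0 : degIn D N y = 0 := by
        have hle : degIn D N y ≤ ∑ z ∈ N, degIn D N z := single_le_sum (fun _ _ => Nat.zero_le _) hy
        rw [hTf, hM0, mul_zero] at hle
        exact Nat.le_zero.mp hle
      unfold degIn at h0
      rw [card_eq_zero, filter_eq_empty_iff] at h0
      exact h0 hy' hyy'
    have hnoR' : ∀ u ∈ R, ∀ u', D.Adj u u' → u' ∉ R := by
      intro u hu u' huu' hu'
      have h0 := hnoR u hu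
      unfold degIn at h0
      rw [card_eq_zero, filter_eq_empty_iff] at h0
      exact h0 hu' huu'
    refine ⟨Nᶜ, ?_, ?_⟩
    · rw [card_compl, hKdef]
      omega
    · intro p q hpq
      rw [mem_compl, mem_compl, not_not]
      constructor
      · intro hpN
        by_contra hqN
        by_cases hpx : p = x
        · subst hpx
          exact hqN ((hmemN q).mpr hpq)
        by_cases hqx : q = x
        · subst hqx
          exact hpN ((hmemN p).mpr (D.adj_symm hpq))
        have hpR : p ∈ R := (hmemR p).mpr ⟨hpx, fun h => hpN ((hmemN p).mpr h)⟩
        have hqR : q ∈ R := (hmemR q).mpr ⟨hqx, fun h => hqN ((hmemN q).mpr h)⟩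
        exact hnoR' p hpR q hpq hqR
      · intro hqN hpN
        exact hnoN p hpN q hpq hqN
  · right
    have hM1'' : M = 1 := by omega
    subst hM1''
    have hP : P + r + 1 + K = (a' + 5) * K := by omega
    have hPle' : ∀ u ∈ R, degIn D N u + 1 ≤ K := hPle
    have hsumR' : ∑ u ∈ R, degIn D N u + 1 = R.card * (K - 1) := by
      rw [hPdef]
      have e : R.card = a' + 4 := by omega
      rw [e]
      obtain ⟨K', rfl⟩ : ∃ K', K = K' + 1 := ⟨K - 1, by omega⟩
      rw [Nat.add_sub_cancel]
      nlinarith [hP, hra]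
    have hSR := capT_R_sum D R N K 1 (by omega) hPle' hsumR' (le_refl 1)
    have hdegRu : ∀ t ∈ R, deg D t = degIn D N t := fun t ht => by
      rw [hdegR t ht, hnoR t ht, add_zero]
    have hSR' : ∑ u ∈ R, deg D u * deg D u + (2 * K - 3) * 1 ≤ (a' + 5 - 1) * ((K - 1) * (K - 1)) := by
      rw [sum_congr rfl (fun t ht => by rw [hdegRu t ht])]
      have e : R.card = a' + 5 - 1 := by omega
      rw [← e]
      exact hSR
    have hfg : ∑ y ∈ N, degIn D N y * degIn D R y ≤ a' + 4 := by
      have := two_mul_sum_degIn_mul_degIn_le D hK x R (fun u hu => ((hmemR u).mp hu).1)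
      rw [← hN, hM] at this
      have e : R.card = a' + 4 := by omega
      rw [e] at this
      omega
    have hSN : ∑ y ∈ N, deg D y * deg D y ≤ K + 6 + (a' + 5 + 1) * P + 2 * (a' + 5 - 1) := by
      have h : ∀ y ∈ N, deg D y * deg D y ≤
          1 + 3 * degIn D N y + (a' + 5 + 1) * degIn D R y + 2 * (degIn D N y * degIn D R y) := by
        intro y hy
        rw [hdegN y hy]
        apply cap_sq_bound_gen
        · have h1 := degIn_nbhd_le_one D hK (x := x) (u := y) ((hmemN y).mp hy)
          rw [← hN] at h1
          exact h1
        · have := degIn_le_card D R y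
          omega
      calc ∑ y ∈ N, deg D y * deg D y
          ≤ ∑ y ∈ N, (1 + 3 * degIn D N y + (a' + 5 + 1) * degIn D R y + 2 * (degIn D N y * degIn D R y)) :=
            sum_le_sum h
        _ = N.card + 3 * ∑ y ∈ N, degIn D N y + (a' + 5 + 1) * ∑ y ∈ N, degIn D R y +
            2 * ∑ y ∈ N, degIn D N y * degIn D R y := by
          rw [sum_add_distrib, sum_add_distrib, sum_add_distrib, sum_const, smul_eq_mul, mul_one, mul_sum,
            mul_sum, mul_sum]
        _ ≤ K + 6 + (a' + 5 + 1) * P + 2 * (a' + 5 - 1) := by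
          rw [hKdef, hTf, sum_degIn_comm D N R, hPdef]
          have e : a' + 5 - 1 = a' + 4 := by omega
          rw [e]
          omega
    rw [hsplit (fun v => deg D v * deg D v), hdx, hKdef, hmdef, hcardV]
    exact capT_sq_arith_corner (a' + 5) K P _ _ m r ha5 hra hK2a hm hP hSN hSR'

end C047

end TriangleCap

end PercRepro
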